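import Summits.BirchSwinnertonDyer.BirchSwinnertonDyer.Theorems.KolyvaginDepthDoorMSymbolCert718b1Twist7
import Summits.BirchSwinnertonDyer.BirchSwinnertonDyer.Theorems.KolyvaginDepthDoorDepthTableKuriharaRow389a1CertifiedT
import Summits.BirchSwinnertonDyer.BirchSwinnertonDyer.Theorems.KolyvaginDepthDoorDepthTableKuriharaRow718b1p5CertifiedE
import Summits.BirchSwinnertonDyer.BirchSwinnertonDyer.Theorems.KolyvaginDepthDoorMSymbolCert709a1
import Summits.BirchSwinnertonDyer.BirchSwinnertonDyer.Theorems.KolyvaginDepthDoorDepthTableRankTwo718b1TwistBSDQuotientUniform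
import Summits.BirchSwinnertonDyer.Rank1Residual.Supersingular.CountPointsFast
import Literature.NumberTheory.EllipticCurves.BurungaleSkinnerTianWan2024.CyclotomicPConverseOverQProofs
import Literature.NumberTheory.EllipticCurves.BSDSelmerPConverseSerreProofs
import HarnessLib

/-!
# Route `KolyvaginDepthDoor`, crux `KolyvaginDepthSupplyKN` (stmt-BirchSwinnertonDyer-22820) —
# DEPTH TABLE v29 «THE CHEAPEST ADMISSIBLE PRIME»: the COMPOSITE-conductor row `718b1` @ `(5, −7)` with BOTH Kurihara claims PROVED

Helper file of the lead prover of line `levelone` (kdd-p1 g34; `--supports stmt-BirchSwinnertonDyer-22820 --as helper`); it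
closes nothing and BSD is NOT proved by it. Sibling of `…KuriharaRow446d1Neg23CertifiedT` / `…794a1Neg23CertifiedT` at the prime `5`
(the lineage's sockets for `718b1` sit at its prime of record; at `5` every side condition of `E = 718b1` is a kernel theorem of the v24
decisive-pair row `…DecisivePair718b1p5(Cert)`, and the E-side claim at the cyclic level `10721 = 71·151` is `C718b1.kuriharaClaim_5_10721`
of `…Row718b1p5CertifiedE`): §1 the Kurihara data of `T₀ = 718b1 ⊗ χ₋₇ = ⟨1, 1, 0, -221, -307⟩` at `(5, 101)` (`101` a cyclic Kolyvagin prime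
of `(T₀, 5)`: `#T̃₀(𝔽_101) = 105`; table `Cert709a1.tab101` REUSED (row `709a1` @ `(5, 71·101)`); the twisted minus sums `sigmaT` of `…MSymbolCert718b1Twist7`; `kSumT ≡ 4
(mod 5)`); §2 `exists_kuriharaNumber_ne_zero_T0` (|C|₅ = 1); §3 `C718b1.minTwist7_isCyclicKolyvaginLevel_5_101`, `C718b1.minTwist7_nonAnomalous_5`,
**`C718b1.kuriharaClaimT_5_101`** and **`C718b1.cruxBody_of_print_5_neg7`** — the clause of `KolyvaginDepthSupplyKN` at `W = 718b1` for every
`K` with `d_K = −7`, by v17's generic `cruxBody_of_kuriharaClaims_spade` with BOTH claims discharged, conditional on the four print facts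
(Kim Thm 1.11, modularity, Mazur Cor 4.1, W. Zhang L8.4 (1)/9.1) ONLY. Per curve; nothing class-wide.

References: [Kim2022StructureSelmer] Thm. 1.11, §1.4.3; [MazurTateTeitelbaum1986Invent] §I.8; [CremonaAlgorithms1997] §2.8, Table 1 (718b1);
[WZhang2014] L8.4 (1), Thm. 9.1; [Mazur1978] Cor. 4.1; [GrossLMS1991] Prop. 3.7 (2); [Serre1972] §4.2.
-/

set_option linter.dupNamespace false

noncomputable section

open scoped MatrixGroups ModularForm Classical NumberField
open CongruenceSubgroup
open Literature.NumberTheory.EllipticCurves Literature.NumberTheory.EllipticCurves.ModularForms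
open Literature.NumberTheory.EllipticCurves.BurungaleSkinnerTianWan2024
  (hasIrreducibleModPGaloisRep_of_smul_eq_quadraticTwist)
open Summit.BirchSwinnertonDyer.BirchSwinnertonDyer.Rank2Observatory
open Summit.BirchSwinnertonDyer.BirchSwinnertonDyer.Theorems.KolyvaginDepthDoor.MSymbolCert.Cert389a1
  (exists_mul_eq_half kuriharaNumber_ne_zero_of_const)
open Summit.BirchSwinnertonDyer.BirchSwinnertonDyer.Theorems.KolyvaginDepthDoor.MSymbolCert.Cert709a1 (tab101 tabOK_101 tabSurj_101)
open Summit.BirchSwinnertonDyer.BirchSwinnertonDyer.Theorems.KolyvaginDepthDoor (C718b1.minTwist7_isElliptic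
  C718b1.minTwist7_isGloballyMinimal C718b1.minTwist7_intModel C718b1.minTwist7_smul_eq)

namespace Summit.BirchSwinnertonDyer.BirchSwinnertonDyer.Theorems.KolyvaginDepthDoor.MSymbolCert.Cert718b1

/-! ## §1 The Kurihara data of `T₀` at `(5, 101)` -/

/-- The table family for `m = 101`. [folklore] -/
def Tw707 (ℓ : ℕ) : List ℕ := if ℓ = 101 then tab101 else []

/-- Admissibility of the table family. [folklore] -/
theorem Tw707_ok : ∀ ℓ, Tw707 ℓ = [] ∨ (ℓ.Prime ∧ tabOK ℓ 5 (Tw707 ℓ) = true) := by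
  intro ℓ
  by_cases h : ℓ = 101
  · right
    rw [h, Tw707, if_pos rfl]
    exact ⟨by norm_num, tabOK_101⟩
  · left; simp [Tw707, h]

/-- Surjectivity at the prime factors of `101`. [folklore] -/
theorem Tw707_surj : ∀ ℓ ∈ (101 : ℕ).primeFactors, tabSurj ℓ 5 (Tw707 ℓ) = true := by
  rw [show (101 : ℕ).primeFactors = {101} from Nat.Prime.primeFactors (by norm_num)]
  intro ℓ hℓ
  rw [Finset.mem_singleton] at hℓ
  rw [hℓ, Tw707, if_pos rfl]
  exact tabSurj_101

/-- The unit witness `sigmaT 1 = -4` (`5 ∤ -4`; decide). [folklore] -/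
theorem sigmaT_witness : sigmaT 1 = (-4) := by
  decide +kernel

set_option maxHeartbeats 4000000 in
/-- **The twisted Kurihara sum is `≢ 0 (mod 5)`** (decide: `≡ 4`). [cite: Kim2022StructureSelmer, §1.4.3] -/
theorem kSumT_ne_zero : kSum 5 101 sigmaT (101 : ℕ).primeFactors Tw707 ≠ 0 := by
  rw [show (101 : ℕ).primeFactors = {101} from Nat.Prime.primeFactors (by norm_num), kSum, ← list_range_map_sum]
  decide +kernel

/-! ## §2 The Kurihara number of the newform of `T₀` -/

/-- **`δ̃_{101}(T₀) ≢ 0 (mod 5)` from modularity of `718b1` by name.** [cite: Kim2022StructureSelmer, §1.4.3] [cite: MazurTateTeitelbaum1986Invent, §I.8] -/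
theorem exists_kuriharaNumber_ne_zero_T0 (hnf : exists_isNewformOf) (N : ℕ) (hN : N = 35182) [NeZero N]
    (D : haveI := C718b1.minTwist7_isElliptic; ModularParametrizationData T0 N) :
    ∃ ψ : (ℓ : ℕ) → (ZMod ℓ)ˣ →* Multiplicative (ZMod 5),
      (∀ ℓ ∈ (101 : ℕ).primeFactors, Function.Surjective (ψ ℓ)) ∧ kuriharaNumber D.f 5 101 ψ ≠ 0 := by
  subst hN
  haveI := C718b1.minTwist7_isElliptic
  haveI := C718b1.minTwist7_isGloballyMinimal
  haveI := isElliptic_c718b1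
  haveI := isGloballyMinimal_c718b1
  haveI : Fact (Nat.Prime 5) := ⟨by norm_num⟩
  haveI : NeZero (101 : ℕ) := ⟨by norm_num⟩
  have hg := D.isNewformOf
  obtain ⟨C, hCall, hCval⟩ := exists_const_T0 hnf D.f hg
  obtain ⟨k, hk⟩ := exists_mul_eq_half D.f hg.1 hg.coeffField_eq_bot hCall
  have hirrE : (((⟨1, 0, 1, -5, 0⟩ : WeierstrassCurve ℤ).map (Int.castRingHom ℚ))).HasIrreducibleModPGaloisRep 5 :=
    hasIrreducibleModPGaloisRep_of_hasSurjectiveModNGaloisRep _ 5 C718b1.hasSurjectiveModNGaloisRep_5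
  have hirr : T0.HasIrreducibleModPGaloisRep 5 :=
    hasIrreducibleModPGaloisRep_of_smul_eq_quadraticTwist (((⟨1, 0, 1, -5, 0⟩ : WeierstrassCurve ℤ).map (Int.castRingHom ℚ))) T0 5 (d := -7) (by norm_num)
      C718b1.minTwist7_smul_eq hirrE
  have hle : ‖((ratPlusSymbol D.f (((1 : ℕ) : ℚ) / 101) : ℚ) : ℚ_[5])‖ ≤ 1 := by
    refine IsNewformOf.norm_ratPlusSymbol_le_one hg (by norm_num) hirr ?_
    have hden : (((1 : ℕ) : ℚ) / 101).den = 101 := by norm_num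
    rw [hden]; norm_num
  rw [hCval 1 (by norm_num) (by norm_num), sigmaT_witness] at hle
  have h2 : ‖(2 : ℚ_[5])‖ = 1 := by
    have := (Padic.norm_natCast_eq_one_iff (p := 5) (n := 2)).mpr (by norm_num)
    simpa using this
  have hv : ‖(((((-4)) : ℤ) : ℚ) : ℚ_[5])‖ = 1 := by
    rw [Rat.cast_intCast]
    refine le_antisymm (Padic.norm_int_le_one _) (not_lt.mp fun hlt => ?_)
    exact absurd (Padic.norm_intCast_lt_one_iff.mp hlt) (by norm_num)
  have hle' : ‖(C : ℚ_[5])‖ ≤ 1 := by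
    have e : ((C * ((((-4)) : ℤ) : ℚ) : ℚ) : ℚ_[5]) = (C : ℚ_[5]) * (((((-4)) : ℤ) : ℚ) : ℚ_[5]) := by push_cast; ring
    rw [e, norm_mul, hv, mul_one] at hle
    exact hle
  have hk1 : ‖((k : ℤ) : ℚ_[5])‖ ≤ 1 := Padic.norm_int_le_one k
  have hprod : ‖(C : ℚ_[5])‖ * ‖((k : ℤ) : ℚ_[5])‖ = 1 := by
    have e : ((C * k : ℚ) : ℚ_[5]) = (C : ℚ_[5]) * ((k : ℤ) : ℚ_[5]) := by push_cast; ring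
    rw [← norm_mul, ← e, hk]
    push_cast
    rw [norm_div, norm_one, h2]; norm_num
  have hC7 : ‖(C : ℚ_[5])‖ = 1 := by
    apply le_antisymm hle'
    nlinarith [norm_nonneg (C : ℚ_[5]), norm_nonneg ((k : ℤ) : ℚ_[5])]
  have hCq : (C : ℚ_[5]) = ((C.num : ℤ) : ℚ_[5]) / ((C.den : ℕ) : ℚ_[5]) := by
    rw [← Rat.cast_intCast, ← Rat.cast_natCast, ← Rat.cast_div, Rat.num_div_den]
  have hdpos : 0 < ‖((C.den : ℕ) : ℚ_[5])‖ := norm_pos_iff.mpr (by exact_mod_cast C.den_ne_zero)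
  have hC7' : ‖((C.num : ℤ) : ℚ_[5])‖ = ‖((C.den : ℕ) : ℚ_[5])‖ := by
    rw [hCq, norm_div, div_eq_one_iff_eq hdpos.ne'] at hC7
    exact hC7
  have hden : ¬ 5 ∣ C.den := fun h => by
    have hlt : ‖((C.den : ℕ) : ℚ_[5])‖ < 1 := Padic.norm_natCast_lt_one_iff.mpr h
    have hnumlt : ‖((C.num : ℤ) : ℚ_[5])‖ < 1 := by rw [hC7']; exact hlt
    have h7num : (5 : ℤ) ∣ C.num := Padic.norm_intCast_lt_one_iff.mp hnumlt
    have hg7 : (5 : ℕ) ∣ Nat.gcd C.num.natAbs C.den := Nat.dvd_gcd (Int.natAbs_dvd_natAbs.mpr h7num) h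
    rw [C.reduced] at hg7
    omega
  have hnum : ¬ (5 : ℤ) ∣ C.num := fun h => by
    have hlt : ‖((C.num : ℤ) : ℚ_[5])‖ < 1 := Padic.norm_intCast_lt_one_iff.mpr h
    have hden1 : ‖((C.den : ℕ) : ℚ_[5])‖ = 1 :=
      Padic.norm_natCast_eq_one_iff.mpr ((Nat.Prime.coprime_iff_not_dvd (by norm_num)).mpr hden)
    rw [hden1] at hC7'
    linarith
  refine ⟨tabFamily 5 Tw707 Tw707_ok, fun ℓ hℓ =>
    surjective_tabFamily 5 Tw707 Tw707_ok (Nat.prime_of_mem_primeFactors hℓ) (Tw707_surj ℓ hℓ), ?_⟩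
  exact kuriharaNumber_ne_zero_of_const D.f 5 101 (by norm_num) Tw707 Tw707_ok sigmaT C hnum hden
    (fun a ha hac => hCval a ha hac) kSumT_ne_zero

end Summit.BirchSwinnertonDyer.BirchSwinnertonDyer.Theorems.KolyvaginDepthDoor.MSymbolCert.Cert718b1

/-! ## §3 The row: both claims discharged -/

namespace Summit.BirchSwinnertonDyer.BirchSwinnertonDyer.Theorems.KolyvaginDepthDoor

open WeierstrassCurve NumberField IsDedekindDomain
open Summit.BirchSwinnertonDyer.BirchSwinnertonDyer.Theorems
open Summit.BirchSwinnertonDyer.BirchSwinnertonDyer.Rank1Residual (IntModel.frobeniusTrace_eq)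
open Summit.BirchSwinnertonDyer.Rank1Residual.Supersingular (natCard_point_eq_of_countPoints countPoints_eq_of_fast)
open Summit.BirchSwinnertonDyer.Rank1Residual.Additive (card_torsion_le_of_intModel_of_card isKolyvaginPrime_of_intModel_of_card)

namespace C718b1

/-- `#T̃₀(𝔽_101) = 105` for `T₀ = ⟨1, 1, 0, -221, -307⟩` (`101 ≡ 1 (mod 5)`, `a_101(T₀) = -3 ≡ 2 (mod 5)`, `25 ∤ 105`), kernel-decided
(`countPointsFast`). [cite: Kim2022StructureSelmer, §1.2.2 (PDF p. 5)] -/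
theorem minTwist7_card_101 :
    Nat.card (((⟨1, 1, 0, -221, -307⟩ : WeierstrassCurve ℤ).map (Int.castRingHom (ZMod 101))).toAffine.Point) = 105 :=
  haveI : Fact (Nat.Prime 101) := ⟨by norm_num⟩
  natCard_point_eq_of_countPoints 1 1 0 (-221) (-307) 101 (by norm_num) (by decide +kernel) (n := 105)
    (countPoints_eq_of_fast (by decide +kernel))

/-- **`101` is a CYCLIC KOLYVAGIN PRIME for `(T₀, 5)`** (`101 ∤ 5·N_{T₀}`, `101 ≡ 1`, `a_101(T₀) ≡ 2 (mod 5)`, `#T̃₀(𝔽_101)[5] ≤ 5`).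
[cite: Kim2022StructureSelmer, §1.2.2 (PDF p. 5)] -/
theorem minTwist7_isCyclicKolyvaginLevel_5_101 :
    haveI := minTwist7_isGloballyMinimal; haveI := Fact.mk (by norm_num : Nat.Prime 5);
    IsCyclicKolyvaginLevel (((⟨1, 1, 0, -221, -307⟩ : WeierstrassCurve ℤ).map (Int.castRingHom ℚ))) 5 101 := by
  haveI := minTwist7_isElliptic
  haveI := minTwist7_isGloballyMinimal
  haveI := Fact.mk (by norm_num : Nat.Prime 5)
  haveI : Fact (Nat.Prime 101) := ⟨by norm_num⟩
  have hℓ : Kato.IsKolyvaginPrime (((⟨1, 1, 0, -221, -307⟩ : WeierstrassCurve ℤ).map (Int.castRingHom ℚ))) 5 1 101 :=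
    isKolyvaginPrime_of_intModel_of_card minTwist7_intModel 5 1 101 (by norm_num) (by decide +kernel) (by decide)
      minTwist7_card_101 (by norm_num)
  refine ⟨⟨Nat.squarefree_iff_nodup_primeFactorsList (by norm_num) |>.mpr (by simp), fun ℓ hℓ' ↦ ?_⟩, fun ℓ hℓ' hdvd ↦ ?_⟩
  · rw [show (101 : ℕ).primeFactors = {101} from (Nat.Prime.primeFactors (by norm_num)), Finset.mem_singleton] at hℓ'
    exact hℓ' ▸ hℓ
  · obtain rfl := (Nat.prime_dvd_prime_iff_eq hℓ'.out (by norm_num)).mp hdvd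
    exact card_torsion_le_of_intModel_of_card minTwist7_intModel 5 101 minTwist7_card_101 (by norm_num)

/-- **`5` is non-anomalous for `T₀`**: `a_5(T₀) = -3` (`5` splits in `ℚ(√−7)`, `a_5(T₀) = a_5(E)`), `5 ∤ a_5(T₀) − 1`.
[cite: SilvermanAEC2009, VII.3 Prop. 3.1] -/
theorem minTwist7_nonAnomalous_5 :
    haveI := minTwist7_isGloballyMinimal; haveI := Fact.mk (by norm_num : Nat.Prime 5);
    ¬ ((5 : ℕ) : ℤ) ∣ (((⟨1, 1, 0, -221, -307⟩ : WeierstrassCurve ℤ).map (Int.castRingHom ℚ))).frobeniusTrace 5 - 1 := by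
  haveI := minTwist7_isElliptic
  haveI := minTwist7_isGloballyMinimal
  haveI := Fact.mk (by norm_num : Nat.Prime 5)
  rw [IntModel.frobeniusTrace_eq minTwist7_intModel minTwist7_card_5]
  decide

/-- **THE TWIST-SIDE KURIHARA CLAIM OF ROW `718b1` @ `(5, −7)` FROM MODULARITY BY NAME** (claim for `T₀` @ `(5, 101)`).
[cite: Kim2022StructureSelmer, §1.4.3] [cite: MazurTateTeitelbaum1986Invent, §I.8] -/
theorem kuriharaClaimT_5_101 (hnf : exists_isNewformOf) :
    haveI := minTwist7_isElliptic; haveI := minTwist7_isGloballyMinimal;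
    haveI : NeZero ((((⟨1, 1, 0, -221, -307⟩ : WeierstrassCurve ℤ).map (Int.castRingHom ℚ))).conductorNorm ℤ) := neZero_conductorNorm_of_isElliptic _;
    haveI := Fact.mk (by norm_num : Nat.Prime 5);
      ∀ (D : ModularParametrizationData (((⟨1, 1, 0, -221, -307⟩ : WeierstrassCurve ℤ).map (Int.castRingHom ℚ))) ((((⟨1, 1, 0, -221, -307⟩ : WeierstrassCurve ℤ).map (Int.castRingHom ℚ))).conductorNorm ℤ)),
      ¬ ((5 : ℕ) : ℤ) ∣ D.maninConstant →
      (∃ u : ℚ, ‖(u : ℚ_[5])‖ = 1 ∧ (((⟨1, 1, 0, -221, -307⟩ : WeierstrassCurve ℤ).map (Int.castRingHom ℚ))).realPeriodRat = u * plusPeriod D.f) →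
      ∃ ψ : (ℓ : ℕ) → (ZMod ℓ)ˣ →* Multiplicative (ZMod 5),
        (∀ ℓ ∈ (101 : ℕ).primeFactors, Function.Surjective (ψ ℓ)) ∧ kuriharaNumber D.f 5 101 ψ ≠ 0 := by
  intro D _ _
  haveI := minTwist7_isElliptic
  haveI : NeZero ((((⟨1, 1, 0, -221, -307⟩ : WeierstrassCurve ℤ).map (Int.castRingHom ℚ))).conductorNorm ℤ) := neZero_conductorNorm_of_isElliptic _
  exact MSymbolCert.Cert718b1.exists_kuriharaNumber_ne_zero_T0 hnf _ MSymbolCert.Cert718b1.conductorNorm_T0 D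

/-- **DEPTH-TABLE ROW `718b1` (COMPOSITE CONDUCTOR `2·359`), `(p, d_K) = (5, −7)`, v29 «THE CHEAPEST ADMISSIBLE PRIME» — NO
COMPUTATIONAL CLAIM LEFT.** For every imaginary quadratic `K` with `d_K = −7`: granted Kim's Thm. 1.11 (`hKim`), modularity (`hnf`),
Mazur's Cor. 4.1 (`hMaz`), W. Zhang's L8.4 (1)/9.1 (`h84`) BY NAME, the clause of the crux `KolyvaginDepthSupplyKN` holds at `W = 718b1`
VERBATIM: v17's generic `cruxBody_of_kuriharaClaims_spade` at `p = 5` (admissible for `718b1`: good ordinary, `ρ̄_{E,5}` onto + Serre's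
tower, non-anomalous, Kodaira–Néron, ♠ (1); all kernel theorems of the lineage) with the E-side claim `kuriharaClaim_5_10721`
(`…Row718b1p5CertifiedE`) and the twist-side claim `kuriharaClaimT_5_101` at the cyclic Kolyvagin prime `101` of `(T₀, 5)` BOTH
PROVED. CONDITIONAL on the four named print facts ONLY; per curve; nothing class-wide; BSD is not proved by it.
[cite: Kim2022StructureSelmer, Thm. 1.11 (PDF p. 8)] [cite: WZhang2014, Lemma 8.4 (1) (p. 236), Thm. 9.1 (p. 240)] [cite: Mazur1978, Cor. 4.1]
[cite: Serre1972, §4.2 Thm. 2] [cite: CremonaAlgorithms1997, Table 1 (718b1)] -/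
theorem cruxBody_of_print_5_neg7
    (hKim : Kim2022_card_selmerGroup_le_pow_of_kuriharaNumber_ne_zero)
    (hnf : exists_isNewformOf) (hMaz : mazur_not_dvd_maninConstant_of_odd)
    (h84 : Literature.NumberTheory.EllipticCurves.WZhang2014_lemma84_exists_minimal_kolyvaginClass_one_selmerCard)
    (K : Type) [Field K] [NumberField K] (hK : IsImaginaryQuadratic K) (hD : NumberField.discr K = -7) :
    haveI := isElliptic_c718b1; haveI := isGloballyMinimal_c718b1;
    ∃ (p : ℕ) (hp : Fact p.Prime), 5 ≤ p ∧ (((⟨1, 0, 1, -5, 0⟩ : WeierstrassCurve ℤ).map (Int.castRingHom ℚ))).HasGoodReductionAtPrime p ∧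
      ¬ (p : ℤ) ∣ (((⟨1, 0, 1, -5, 0⟩ : WeierstrassCurve ℤ).map (Int.castRingHom ℚ))).frobeniusTrace p ∧
      (∀ n : ℕ, (((⟨1, 0, 1, -5, 0⟩ : WeierstrassCurve ℤ).map (Int.castRingHom ℚ))).HasSurjectiveModNGaloisRep (p ^ n : ℕ)) ∧
      (∀ v : HeightOneSpectrum (𝓞 ℚ), (((⟨1, 0, 1, -5, 0⟩ : WeierstrassCurve ℤ).map (Int.castRingHom ℚ))).HasMultiplicativeReductionAt v →
        ¬ p ∣ (((⟨1, 0, 1, -5, 0⟩ : WeierstrassCurve ℤ).map (Int.castRingHom ℚ))).ordMinimalDiscriminant v) ∧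
      ∃ (K : Type) (_ : Field K) (_ : NumberField K), IsImaginaryQuadratic K ∧
        NumberField.discr K ≠ -3 ∧ NumberField.discr K ≠ -4 ∧
        ∃ (_ : NeZero ((((⟨1, 0, 1, -5, 0⟩ : WeierstrassCurve ℤ).map (Int.castRingHom ℚ))).conductorNorm ℤ)),
          SatisfiesHeegnerHypothesis ((((⟨1, 0, 1, -5, 0⟩ : WeierstrassCurve ℤ).map (Int.castRingHom ℚ))).conductorNorm ℤ) K ∧
        ∃ (Dt : ModularParametrizationData (((⟨1, 0, 1, -5, 0⟩ : WeierstrassCurve ℤ).map (Int.castRingHom ℚ))) ((((⟨1, 0, 1, -5, 0⟩ : WeierstrassCurve ℤ).map (Int.castRingHom ℚ))).conductorNorm ℤ))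
          (β : ℤ) (ι : K →+* ℂ) (n₁ : ℕ) (d : KolyvaginHeegnerData Dt β ι n₁), Squarefree n₁ ∧
          (∀ q ∈ n₁.primeFactors, Zhang2014.IsKolyvaginPrime ((((⟨1, 0, 1, -5, 0⟩ : WeierstrassCurve ℤ).map (Int.castRingHom ℚ))).conductorNorm ℤ)
            (((⟨1, 0, 1, -5, 0⟩ : WeierstrassCurve ℤ).map (Int.castRingHom ℚ))) K p q) ∧
          d.kolyvaginClass hp.out 1 ≠ 0 ∧
          (n₁.primeFactors.card + 1 ≤ (((⟨1, 0, 1, -5, 0⟩ : WeierstrassCurve ℤ).map (Int.castRingHom ℚ))).mordellWeilRank ∨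
            (n₁.primeFactors.card ≤ (((⟨1, 0, 1, -5, 0⟩ : WeierstrassCurve ℤ).map (Int.castRingHom ℚ))).mordellWeilRank ∧
              n₁.primeFactors.card + 1 ≤ ((((⟨1, 0, 1, -5, 0⟩ : WeierstrassCurve ℤ).map (Int.castRingHom ℚ))).quadraticTwist
                (NumberField.discr K : ℚ)).mordellWeilRank)) := by
  haveI := isElliptic_c718b1
  haveI := isGloballyMinimal_c718b1
  haveI iNZ : NeZero ((((⟨1, 0, 1, -5, 0⟩ : WeierstrassCurve ℤ).map (Int.castRingHom ℚ))).conductorNorm ℤ) := neZero_conductorNorm_of_isElliptic _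
  haveI := minTwist7_isElliptic
  haveI := minTwist7_isGloballyMinimal
  haveI iNZT : NeZero ((((⟨1, 1, 0, -221, -307⟩ : WeierstrassCurve ℤ).map (Int.castRingHom ℚ))).conductorNorm ℤ) := neZero_conductorNorm_of_isElliptic _
  haveI iP := Fact.mk (by norm_num : Nat.Prime 5)
  haveI : NeZero (10721 : ℕ) := ⟨by norm_num⟩
  haveI : NeZero (101 : ℕ) := ⟨by norm_num⟩
  have hsp := spadeOne_of_five_le 5 le_rfl
  have hS2 : ¬ Squarefree ((((⟨1, 0, 1, -5, 0⟩ : WeierstrassCurve ℤ).map (Int.castRingHom ℚ))).conductorNorm ℤ) →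
      (∃ (ℓ : ℕ) (_ : Fact ℓ.Prime), (((⟨1, 0, 1, -5, 0⟩ : WeierstrassCurve ℤ).map (Int.castRingHom ℚ))).HasMultiplicativeReductionAtPrime ℓ ∧
          ¬ 5 ∣ padicValInt ℓ (((⟨1, 0, 1, -5, 0⟩ : WeierstrassCurve ℤ).map (Int.castRingHom ℚ))).minimalDiscriminantInt) ∧
        ∃ (ℓ₁ ℓ₂ : ℕ) (_ : Fact ℓ₁.Prime) (_ : Fact ℓ₂.Prime), ℓ₁ ≠ ℓ₂ ∧
          (((⟨1, 0, 1, -5, 0⟩ : WeierstrassCurve ℤ).map (Int.castRingHom ℚ))).HasMultiplicativeReductionAtPrime ℓ₁ ∧ (((⟨1, 0, 1, -5, 0⟩ : WeierstrassCurve ℤ).map (Int.castRingHom ℚ))).HasMultiplicativeReductionAtPrime ℓ₂ :=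
    fun hns ↦ absurd ((((⟨1, 0, 1, -5, 0⟩ : WeierstrassCurve ℤ).map (Int.castRingHom ℚ))).isSemistable_iff_squarefree_conductorNorm.mp hsp.2) hns
  have hH := satisfiesHeegnerHypothesis_conductorNorm_of_intModel intModel K hK.1 hD heegner_neg7
  have hD3 : NumberField.discr K ≠ -3 := by rw [hD]; norm_num
  have hD4 : NumberField.discr K ≠ -4 := by rw [hD]; norm_num
  have hpD : ¬ (((5 : ℕ) : ℤ) ∣ NumberField.discr K) := by rw [hD]; decide
  have hsur : (((⟨1, 0, 1, -5, 0⟩ : WeierstrassCurve ℤ).map (Int.castRingHom ℚ))).HasSurjectiveModNGaloisRep ((5 : ℕ) : ℤ) := by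
    simpa using hasSurjectiveModNGaloisRep_5
  have htower : ∀ k : ℕ, (((⟨1, 0, 1, -5, 0⟩ : WeierstrassCurve ℤ).map (Int.castRingHom ℚ))).HasSurjectiveModNGaloisRep ((5 : ℕ) ^ k : ℕ) :=
    serre_hasSurjectiveModNGaloisRep_pow_holds _ 5 (by norm_num) hsur
  have hC : (⟨1, (-1 : ℚ), -((1 : ℚ) / 2), (1 : ℚ) / 2⟩ : WeierstrassCurve.VariableChange ℚ) • (((⟨1, 1, 0, -221, -307⟩ : WeierstrassCurve ℤ).map (Int.castRingHom ℚ))) = (((⟨1, 0, 1, -5, 0⟩ : WeierstrassCurve ℤ).map (Int.castRingHom ℚ))).quadraticTwist (NumberField.discr K : ℚ) := by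
    rw [hD]; push_cast; exact minTwist7_smul_eq
  have hrank : 2 ≤ (((⟨1, 0, 1, -5, 0⟩ : WeierstrassCurve ℤ).map (Int.castRingHom ℚ))).mordellWeilRank :=
    le_of_eq Summit.BirchSwinnertonDyer.BirchSwinnertonDyer.Rank2Observatory.C718b1.mordellWeilRank_eq_two.symm
  have hν' : (10721 : ℕ).primeFactors.card ≤ (((⟨1, 0, 1, -5, 0⟩ : WeierstrassCurve ℤ).map (Int.castRingHom ℚ))).mordellWeilRank := by
    refine le_trans (le_of_eq ?_) hrank
    rw [MSymbolCert.Level10721.primeFactors_10721]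
    decide
  have hμ' : (101 : ℕ).primeFactors.card ≤ (((⟨1, 0, 1, -5, 0⟩ : WeierstrassCurve ℤ).map (Int.castRingHom ℚ))).mordellWeilRank :=
    le_trans (by rw [Nat.Prime.primeFactors (by norm_num), Finset.card_singleton]; norm_num) hrank
  exact cruxBody_of_kuriharaClaims_spade hKim hnf hMaz h84 _ hrank 5 le_rfl goodOrdinary_5.1 goodOrdinary_5.2 htower
    (kodairaNeron_of_five_le 5 le_rfl) nonAnomalous_5 hsp.1 hS2 K hK hD3 hD4 hpD hH 10721 isCyclicKolyvaginLevel_5_10721 hν'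
    kuriharaClaim_5_10721 (((⟨1, 1, 0, -221, -307⟩ : WeierstrassCurve ℤ).map (Int.castRingHom ℚ))) _ hC minTwist7_nonAnomalous_5 minTwist7_kodairaNeron_5 101 minTwist7_isCyclicKolyvaginLevel_5_101 hμ'
    (kuriharaClaimT_5_101 hnf)

end C718b1

end Summit.BirchSwinnertonDyer.BirchSwinnertonDyer.Theorems.KolyvaginDepthDoor

end
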